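import Mathlib.Analysis.SpecialFunctions.Pow.Real
import HarnessLib

/-!
# Arithmetic of the threshold barrier of Carter's equation: monomial bounds for the affine constants
(namespace `Literature.Geometry.Lorentzian.Kerr`.)

Pure real-variable inequalities. In `CarterThresholdTurningPointTortoise.lean` the coefficient
`q = V∘ρ − ω²` of Carter's equation at the superradiant threshold is controlled on the last stretch
`[s_lo, b₂]` of the Breitenlohner–Freedman barrier by `c₁(b₂ − s) − e₁ ≤ q ≤ c₂(b₂ − s) + e₂` with

  `c₁ = 2ω²(r_lo + r₊)h_lo Δ_lo²/(r_b² + a²)³`,   `e₁ = Δ_b(6(r_b + r₊)/(r_t + r₊) + 3)/(r_lo² + a²)²`,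
  `c₂ = ω²(2(r_t + r₊) + (r_t + r₊)²/(r_lo − r₋))Δ_b²/(r_lo² + a²)³`,   `e₂ = 3Δ_b/(r_lo² + a²)²`,

`h_lo = (r_lo − r₊)/(r_lo − r₋)`, `Δ(r) = (r − r₊)(r − r₋)`. With the MIDPOINT choice `r_lo = r₊ + δ/2`,
`r_b = r₊ + δ` (`δ = r_b − r₊ > 0` the radial width of the far barrier), `r₊ − r₋ ≤ δ/2` (near
extremality), `a² ≤ r₊²`, and `r₊ + δ/2 ≤ r_t ≤ r_b ≤ 2r_t + r₊` (the profile zero sits in the outer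
half), every constant is a MONOMIAL in `(ω², δ, r_b)` up to absolute factors:

* `thresholdBarrier_c₁_ge`, `thresholdBarrier_c₁_le` — `ω²δ⁴/(128r_b⁵) ≤ c₁ ≤ ω²δ⁴/(2r_b⁵)`;
* `thresholdBarrier_e₁_ge`, `thresholdBarrier_e₁_le` — `3δ²/(4r_b⁴) ≤ e₁ ≤ 360δ²/r_b⁴`;
* `thresholdBarrier_c₂_le` — `c₂ ≤ 1728ω²δ³/r_b⁴`;  `thresholdBarrier_e₂_le` — `e₂ ≤ 72δ²/r_b⁴`;
* `thresholdBarrier_ratio_bounds` — for `L = 2e₁/c₁`: `3r_b/(ω²δ²) ≤ L ≤ 92160r_b/(ω²δ²)`;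
* `thresholdBarrier_eight_e₁_le` — if `368640·r_b ≤ ω²δ³` then `8e₁ ≤ c₁δ`;
  `thresholdBarrier_layer_le_one` — if `1.36·10¹⁸ ≤ ω⁴δ³r_b` then `(c₂L + e₁ + e₂)L² ≤ 1` (the last
  Airy layer `[b₂ − L, b₂]` has `|q|L² ≤ 1`);
* `thresholdBarrier_largeness_of_margin` — both largeness conditions follow from `Λ′ ≤ 4ω²r_b²`,
  `θ₁r_b ≤ 3δ` and `2.5·10¹⁰/θ₁³ ≤ Λ′` (`0 < θ₁ ≤ 1`).

These feed the threshold cone kernel bound of the near-extremal Kerr programme (crux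
`KappaExplicitWaveDecay`, BF-stable large-`Λ`); nothing here refers to the Kerr potential itself.

## References
* M. Dafermos, I. Rodnianski, Y. Shlapentokh-Rothman, arXiv:1402.7034 = Ann. of Math. 183 (2016),
  §§5.2.3, 6.2 (key `DafermosRodnianskiShlapentokhrothman2014`). The algebra is folklore.
-/

noncomputable section

namespace Literature.Geometry.Lorentzian

namespace Kerr

section Constants

variable {rp rm δ a ω rt : ℝ}

/-- `c₁ ≥ ω²δ⁴/(128 r_b⁵)` (`r_lo + r₊ ≥ r_b/2`, `h_loΔ_lo² = (δ/2)³(r_lo − r₋) ≥ (δ/2)⁴`,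
`(r_b² + a²)³ ≤ 8r_b⁶`). [folklore] -/
theorem thresholdBarrier_c₁_ge (hrp : 0 < rp) (hd : rm < rp) (hδ : 0 < δ) (ha : a ^ 2 ≤ rp ^ 2) :
    ω ^ 2 * δ ^ 4 / (128 * (rp + δ) ^ 5) ≤
      2 * ω ^ 2 * (rp + δ / 2 + rp) * ((rp + δ / 2 - rp) / (rp + δ / 2 - rm)) *
        ((rp + δ / 2 - rp) * (rp + δ / 2 - rm)) ^ 2 / ((rp + δ) ^ 2 + a ^ 2) ^ 3 := by
  have hD : 0 < rp + δ / 2 - rm := by linarith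
  have hrb : 0 < rp + δ := by linarith
  have e : 2 * ω ^ 2 * (rp + δ / 2 + rp) * ((rp + δ / 2 - rp) / (rp + δ / 2 - rm)) *
        ((rp + δ / 2 - rp) * (rp + δ / 2 - rm)) ^ 2 =
      2 * ω ^ 2 * (rp + δ / 2 + rp) * (δ / 2) ^ 3 * (rp + δ / 2 - rm) := by
    field_simp
    ring
  rw [e]
  have h1 : (rp + δ) / 2 ≤ rp + δ / 2 + rp := by linarith
  have h2 : δ / 2 ≤ rp + δ / 2 - rm := by linarith
  have h3 : ((rp + δ) ^ 2 + a ^ 2) ^ 3 ≤ 8 * (rp + δ) ^ 6 := by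
    have : (rp + δ) ^ 2 + a ^ 2 ≤ 2 * (rp + δ) ^ 2 := by nlinarith
    calc ((rp + δ) ^ 2 + a ^ 2) ^ 3 ≤ (2 * (rp + δ) ^ 2) ^ 3 :=
          pow_le_pow_left₀ (by positivity) this 3
      _ = 8 * (rp + δ) ^ 6 := by ring
  have hA : 0 < ((rp + δ) ^ 2 + a ^ 2) ^ 3 := by positivity
  calc ω ^ 2 * δ ^ 4 / (128 * (rp + δ) ^ 5)
      = 2 * ω ^ 2 * ((rp + δ) / 2) * (δ / 2) ^ 3 * (δ / 2) / (8 * (rp + δ) ^ 6) := by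
        rw [div_eq_div_iff (by positivity) (by positivity)]; ring
    _ ≤ 2 * ω ^ 2 * (rp + δ / 2 + rp) * (δ / 2) ^ 3 * (rp + δ / 2 - rm) /
          ((rp + δ) ^ 2 + a ^ 2) ^ 3 := by
        apply div_le_div₀ (by positivity) _ hA h3
        gcongr

/-- `c₁ ≤ ω²δ⁴/(2 r_b⁵)` (`r_lo + r₊ ≤ 2r_b`, `(δ/2)³(r_lo − r₋) ≤ δ⁴/8`, `(r_b² + a²)³ ≥ r_b⁶`).
[folklore] -/
theorem thresholdBarrier_c₁_le (hrp : 0 < rp) (hd : rm < rp) (hδ : 0 < δ) (hdδ : rp - rm ≤ δ / 2) :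
    2 * ω ^ 2 * (rp + δ / 2 + rp) * ((rp + δ / 2 - rp) / (rp + δ / 2 - rm)) *
        ((rp + δ / 2 - rp) * (rp + δ / 2 - rm)) ^ 2 / ((rp + δ) ^ 2 + a ^ 2) ^ 3 ≤
      ω ^ 2 * δ ^ 4 / (2 * (rp + δ) ^ 5) := by
  have hD : 0 < rp + δ / 2 - rm := by linarith
  have hrb : 0 < rp + δ := by linarith
  have e : 2 * ω ^ 2 * (rp + δ / 2 + rp) * ((rp + δ / 2 - rp) / (rp + δ / 2 - rm)) *
        ((rp + δ / 2 - rp) * (rp + δ / 2 - rm)) ^ 2 =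
      2 * ω ^ 2 * (rp + δ / 2 + rp) * (δ / 2) ^ 3 * (rp + δ / 2 - rm) := by
    field_simp
    ring
  rw [e]
  have h1 : rp + δ / 2 + rp ≤ 2 * (rp + δ) := by linarith
  have h2 : rp + δ / 2 - rm ≤ δ := by linarith
  have h3 : (rp + δ) ^ 6 ≤ ((rp + δ) ^ 2 + a ^ 2) ^ 3 := by
    have : (rp + δ) ^ 2 ≤ (rp + δ) ^ 2 + a ^ 2 := by nlinarith
    calc (rp + δ) ^ 6 = ((rp + δ) ^ 2) ^ 3 := by ring
      _ ≤ ((rp + δ) ^ 2 + a ^ 2) ^ 3 := pow_le_pow_left₀ (by positivity) this 3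
  calc 2 * ω ^ 2 * (rp + δ / 2 + rp) * (δ / 2) ^ 3 * (rp + δ / 2 - rm) / ((rp + δ) ^ 2 + a ^ 2) ^ 3
      ≤ 2 * ω ^ 2 * (2 * (rp + δ)) * (δ / 2) ^ 3 * δ / (rp + δ) ^ 6 := by
        apply div_le_div₀ (by positivity) _ (by positivity) h3
        gcongr
    _ = ω ^ 2 * δ ^ 4 / (2 * (rp + δ) ^ 5) := by
        rw [div_eq_div_iff (by positivity) (by positivity)]; ring

/-- `e₁ ≥ 3δ²/(4 r_b⁴)` (`Δ_b ≥ δ²`, the bracket is `≥ 3`, `(r_lo² + a²)² ≤ 4r_b⁴`). [folklore] -/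
theorem thresholdBarrier_e₁_ge (hrp : 0 < rp) (hd : rm < rp) (hδ : 0 < δ) (ha : a ^ 2 ≤ rp ^ 2)
    (hrt : rp < rt) :
    3 * δ ^ 2 / (4 * (rp + δ) ^ 4) ≤
      (rp + δ - rp) * (rp + δ - rm) * (6 * (rp + δ + rp) / (rt + rp) + 3) /
        ((rp + δ / 2) ^ 2 + a ^ 2) ^ 2 := by
  have hrb : 0 < rp + δ := by linarith
  have h1 : δ ^ 2 ≤ (rp + δ - rp) * (rp + δ - rm) := by nlinarith
  have h2 : (3 : ℝ) ≤ 6 * (rp + δ + rp) / (rt + rp) + 3 := by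
    have : 0 ≤ 6 * (rp + δ + rp) / (rt + rp) := div_nonneg (by linarith) (by linarith)
    linarith
  have h3 : ((rp + δ / 2) ^ 2 + a ^ 2) ^ 2 ≤ 4 * (rp + δ) ^ 4 := by
    have : (rp + δ / 2) ^ 2 + a ^ 2 ≤ 2 * (rp + δ) ^ 2 := by nlinarith
    calc ((rp + δ / 2) ^ 2 + a ^ 2) ^ 2 ≤ (2 * (rp + δ) ^ 2) ^ 2 :=
          pow_le_pow_left₀ (by positivity) this 2
      _ = 4 * (rp + δ) ^ 4 := by ring
  calc 3 * δ ^ 2 / (4 * (rp + δ) ^ 4) = δ ^ 2 * 3 / (4 * (rp + δ) ^ 4) := by ring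
    _ ≤ (rp + δ - rp) * (rp + δ - rm) * (6 * (rp + δ + rp) / (rt + rp) + 3) /
        ((rp + δ / 2) ^ 2 + a ^ 2) ^ 2 := by
        apply div_le_div₀ (mul_nonneg (by nlinarith) (by linarith)) _ (by positivity) h3
        exact mul_le_mul h1 h2 (by norm_num) (by nlinarith)

/-- `e₁ ≤ 360δ²/r_b⁴` (`Δ_b ≤ 3δ²/2`, the bracket is `≤ 15` once `r_b + r₊ ≤ 2(r_t + r₊)`,
`(r_lo² + a²)² ≥ r_b⁴/16`). [folklore] -/
theorem thresholdBarrier_e₁_le (hrp : 0 < rp) (hd : rm < rp) (hδ : 0 < δ) (hdδ : rp - rm ≤ δ / 2)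
    (hrt : rp < rt) (hrt2 : rp + δ + rp ≤ 2 * (rt + rp)) :
    (rp + δ - rp) * (rp + δ - rm) * (6 * (rp + δ + rp) / (rt + rp) + 3) /
        ((rp + δ / 2) ^ 2 + a ^ 2) ^ 2 ≤ 360 * δ ^ 2 / (rp + δ) ^ 4 := by
  have hrb : 0 < rp + δ := by linarith
  have hrt0 : 0 < rt + rp := by linarith
  have h1 : (rp + δ - rp) * (rp + δ - rm) ≤ 3 / 2 * δ ^ 2 := by nlinarith
  have h2 : 6 * (rp + δ + rp) / (rt + rp) + 3 ≤ 15 := by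
    have : 6 * (rp + δ + rp) / (rt + rp) ≤ 12 := by
      rw [div_le_iff₀ hrt0]; linarith
    linarith
  have h3 : (rp + δ) ^ 4 / 16 ≤ ((rp + δ / 2) ^ 2 + a ^ 2) ^ 2 := by
    have h4 : (rp + δ) ^ 2 / 4 ≤ (rp + δ / 2) ^ 2 + a ^ 2 := by nlinarith [sq_nonneg a]
    calc (rp + δ) ^ 4 / 16 = ((rp + δ) ^ 2 / 4) ^ 2 := by ring
      _ ≤ ((rp + δ / 2) ^ 2 + a ^ 2) ^ 2 := pow_le_pow_left₀ (by positivity) h4 2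
  calc (rp + δ - rp) * (rp + δ - rm) * (6 * (rp + δ + rp) / (rt + rp) + 3) /
        ((rp + δ / 2) ^ 2 + a ^ 2) ^ 2
      ≤ 3 / 2 * δ ^ 2 * 15 / ((rp + δ) ^ 4 / 16) := by
        apply div_le_div₀ (by positivity) _ (by positivity) h3
        exact mul_le_mul h1 h2 (by positivity) (by positivity)
    _ = 360 * δ ^ 2 / (rp + δ) ^ 4 := by
        rw [div_eq_div_iff (by positivity) (by positivity)]; ring

/-- `c₂ ≤ 1728ω²δ³/r_b⁴` (`r_t + r₊ ≤ 2r_b`, `r_lo − r₋ ≥ δ/2`, `r_b ≥ δ`, `Δ_b² ≤ 9δ⁴/4`,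
`(r_lo² + a²)³ ≥ r_b⁶/64`). [folklore] -/
theorem thresholdBarrier_c₂_le (hrp : 0 < rp) (hd : rm < rp) (hδ : 0 < δ) (hdδ : rp - rm ≤ δ / 2)
    (hrt : rp < rt) (hrtb : rt ≤ rp + δ) :
    ω ^ 2 * (2 * (rt + rp) + (rt + rp) ^ 2 / (rp + δ / 2 - rm)) *
        ((rp + δ - rp) * (rp + δ - rm)) ^ 2 / ((rp + δ / 2) ^ 2 + a ^ 2) ^ 3 ≤
      1728 * ω ^ 2 * δ ^ 3 / (rp + δ) ^ 4 := by
  have hrb : 0 < rp + δ := by linarith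
  have hD : 0 < rp + δ / 2 - rm := by linarith
  have hω2 : 0 ≤ ω ^ 2 := sq_nonneg ω
  -- the bracket
  have hB : 2 * (rt + rp) + (rt + rp) ^ 2 / (rp + δ / 2 - rm) ≤ 12 * (rp + δ) ^ 2 / δ := by
    have h1 : 2 * (rt + rp) ≤ 4 * (rp + δ) := by linarith
    have h2 : (rt + rp) ^ 2 / (rp + δ / 2 - rm) ≤ (2 * (rp + δ)) ^ 2 / (δ / 2) :=
      div_le_div₀ (by positivity) (pow_le_pow_left₀ (by linarith) (by linarith) 2) (by positivity)
        (by linarith)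
    have h3 : 4 * (rp + δ) ≤ 4 * (rp + δ) ^ 2 / δ := by
      rw [le_div_iff₀ hδ]; nlinarith
    have e : (2 * (rp + δ)) ^ 2 / (δ / 2) = 8 * (rp + δ) ^ 2 / δ := by
      rw [div_eq_div_iff (by positivity) (by positivity)]; ring
    rw [e] at h2
    have : 4 * (rp + δ) ^ 2 / δ + 8 * (rp + δ) ^ 2 / δ = 12 * (rp + δ) ^ 2 / δ := by ring
    linarith
  have hB0 : 0 ≤ 2 * (rt + rp) + (rt + rp) ^ 2 / (rp + δ / 2 - rm) :=
    add_nonneg (by linarith) (div_nonneg (sq_nonneg _) hD.le)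
  have hΔ : ((rp + δ - rp) * (rp + δ - rm)) ^ 2 ≤ (3 / 2 * δ ^ 2) ^ 2 :=
    pow_le_pow_left₀ (by nlinarith) (by nlinarith) 2
  have h3 : (rp + δ) ^ 6 / 64 ≤ ((rp + δ / 2) ^ 2 + a ^ 2) ^ 3 := by
    have h4 : (rp + δ) ^ 2 / 4 ≤ (rp + δ / 2) ^ 2 + a ^ 2 := by nlinarith [sq_nonneg a]
    calc (rp + δ) ^ 6 / 64 = ((rp + δ) ^ 2 / 4) ^ 3 := by ring
      _ ≤ ((rp + δ / 2) ^ 2 + a ^ 2) ^ 3 := pow_le_pow_left₀ (by positivity) h4 3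
  calc ω ^ 2 * (2 * (rt + rp) + (rt + rp) ^ 2 / (rp + δ / 2 - rm)) *
        ((rp + δ - rp) * (rp + δ - rm)) ^ 2 / ((rp + δ / 2) ^ 2 + a ^ 2) ^ 3
      ≤ ω ^ 2 * (12 * (rp + δ) ^ 2 / δ) * (3 / 2 * δ ^ 2) ^ 2 / ((rp + δ) ^ 6 / 64) := by
        apply div_le_div₀ (by positivity) _ (by positivity) h3
        exact mul_le_mul (mul_le_mul_of_nonneg_left hB hω2) hΔ (by positivity) (by positivity)
    _ = 1728 * ω ^ 2 * δ ^ 3 / (rp + δ) ^ 4 := by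
        field_simp
        ring

/-- `e₂ ≤ 72δ²/r_b⁴`. [folklore] -/
theorem thresholdBarrier_e₂_le (hrp : 0 < rp) (hd : rm < rp) (hδ : 0 < δ) (hdδ : rp - rm ≤ δ / 2) :
    3 * ((rp + δ - rp) * (rp + δ - rm)) / ((rp + δ / 2) ^ 2 + a ^ 2) ^ 2 ≤
      72 * δ ^ 2 / (rp + δ) ^ 4 := by
  have hrb : 0 < rp + δ := by linarith
  have h1 : 3 * ((rp + δ - rp) * (rp + δ - rm)) ≤ 9 / 2 * δ ^ 2 := by nlinarith
  have h3 : (rp + δ) ^ 4 / 16 ≤ ((rp + δ / 2) ^ 2 + a ^ 2) ^ 2 := by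
    have h4 : (rp + δ) ^ 2 / 4 ≤ (rp + δ / 2) ^ 2 + a ^ 2 := by nlinarith [sq_nonneg a]
    calc (rp + δ) ^ 4 / 16 = ((rp + δ) ^ 2 / 4) ^ 2 := by ring
      _ ≤ ((rp + δ / 2) ^ 2 + a ^ 2) ^ 2 := pow_le_pow_left₀ (by positivity) h4 2
  calc 3 * ((rp + δ - rp) * (rp + δ - rm)) / ((rp + δ / 2) ^ 2 + a ^ 2) ^ 2
      ≤ 9 / 2 * δ ^ 2 / ((rp + δ) ^ 4 / 16) := div_le_div₀ (by positivity) h1 (by positivity) h3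
    _ = 72 * δ ^ 2 / (rp + δ) ^ 4 := by
        rw [div_eq_div_iff (by positivity) (by positivity)]; ring

/-! ### The Airy length `L = 2e₁/c₁` and the two largeness conditions -/

/-- **Two-sided bounds for `L = 2e₁/c₁`**: from `c₁ ∈ [ω²δ⁴/(128r_b⁵), ω²δ⁴/(2r_b⁵)]`,
`e₁ ∈ [3δ²/(4r_b⁴), 360δ²/r_b⁴]` (`ω ≠ 0`): `3r_b/(ω²δ²) ≤ 2e₁/c₁ ≤ 92160·r_b/(ω²δ²)`. [folklore] -/
theorem thresholdBarrier_ratio_bounds {c₁ e₁ rb : ℝ} (hω : ω ≠ 0) (hδ : 0 < δ) (hrb : 0 < rb)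
    (hc₁ : ω ^ 2 * δ ^ 4 / (128 * rb ^ 5) ≤ c₁) (hc₁' : c₁ ≤ ω ^ 2 * δ ^ 4 / (2 * rb ^ 5))
    (he₁ : 3 * δ ^ 2 / (4 * rb ^ 4) ≤ e₁) (he₁' : e₁ ≤ 360 * δ ^ 2 / rb ^ 4) :
    3 * rb / (ω ^ 2 * δ ^ 2) ≤ 2 * e₁ / c₁ ∧ 2 * e₁ / c₁ ≤ 92160 * rb / (ω ^ 2 * δ ^ 2) := by
  have hω2 : 0 < ω ^ 2 := by positivity
  have hc₁0 : 0 < c₁ := lt_of_lt_of_le (by positivity) hc₁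
  constructor
  · rw [div_le_div_iff₀ (by positivity) hc₁0]
    -- `3 r_b c₁ ≤ 2 e₁ ω² δ²`
    have h1 : 3 * rb * c₁ ≤ 3 * rb * (ω ^ 2 * δ ^ 4 / (2 * rb ^ 5)) :=
      mul_le_mul_of_nonneg_left hc₁' (by positivity)
    have h2 : 2 * (3 * δ ^ 2 / (4 * rb ^ 4)) * (ω ^ 2 * δ ^ 2) ≤ 2 * e₁ * (ω ^ 2 * δ ^ 2) := by
      gcongr
    have e : 3 * rb * (ω ^ 2 * δ ^ 4 / (2 * rb ^ 5)) =
        2 * (3 * δ ^ 2 / (4 * rb ^ 4)) * (ω ^ 2 * δ ^ 2) := by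
      field_simp
      ring
    linarith
  · rw [div_le_div_iff₀ hc₁0 (by positivity)]
    have h1 : 2 * e₁ * (ω ^ 2 * δ ^ 2) ≤ 2 * (360 * δ ^ 2 / rb ^ 4) * (ω ^ 2 * δ ^ 2) := by gcongr
    have h2 : 92160 * rb * (ω ^ 2 * δ ^ 4 / (128 * rb ^ 5)) ≤ 92160 * rb * c₁ :=
      mul_le_mul_of_nonneg_left hc₁ (by positivity)
    have e : 2 * (360 * δ ^ 2 / rb ^ 4) * (ω ^ 2 * δ ^ 2) =
        92160 * rb * (ω ^ 2 * δ ^ 4 / (128 * rb ^ 5)) := by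
      field_simp
      ring
    linarith

/-- **First largeness condition**: if `368640·r_b ≤ ω²δ³` then `8e₁ ≤ c₁δ` (with the bounds above).
[folklore] -/
theorem thresholdBarrier_eight_e₁_le {c₁ e₁ rb : ℝ} (hδ : 0 < δ) (hrb : 0 < rb)
    (hc₁ : ω ^ 2 * δ ^ 4 / (128 * rb ^ 5) ≤ c₁) (he₁' : e₁ ≤ 360 * δ ^ 2 / rb ^ 4)
    (hbig : 368640 * rb ≤ ω ^ 2 * δ ^ 3) : 8 * e₁ ≤ c₁ * δ := by
  have h1 : 8 * e₁ ≤ 8 * (360 * δ ^ 2 / rb ^ 4) := by linarith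
  have h2 : ω ^ 2 * δ ^ 4 / (128 * rb ^ 5) * δ ≤ c₁ * δ := mul_le_mul_of_nonneg_right hc₁ hδ.le
  have h3 : 8 * (360 * δ ^ 2 / rb ^ 4) ≤ ω ^ 2 * δ ^ 4 / (128 * rb ^ 5) * δ := by
    rw [show 8 * (360 * δ ^ 2 / rb ^ 4) = 2880 * δ ^ 2 / rb ^ 4 by ring,
      show ω ^ 2 * δ ^ 4 / (128 * rb ^ 5) * δ = ω ^ 2 * δ ^ 5 / (128 * rb ^ 5) by ring,
      div_le_div_iff₀ (by positivity) (by positivity)]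
    -- `2880 δ² · 128 r_b⁵ ≤ ω² δ⁵ r_b⁴`
    have := mul_le_mul_of_nonneg_right hbig (show 0 ≤ δ ^ 2 * rb ^ 4 by positivity)
    nlinarith [this]
  linarith

/-- **Second largeness condition**: if `8e₁ ≤ c₁δ`-type bounds hold in the form of the monomial bounds
above and `1.36·10¹⁸ ≤ ω⁴δ³r_b` (with `δ ≤ r_b`), then for `L = 2e₁/c₁`:
`(c₂L + e₁ + e₂)·L² ≤ 1`. [folklore] -/
theorem thresholdBarrier_layer_le_one {c₁ e₁ c₂ e₂ rb L : ℝ} (hω : ω ≠ 0) (hδ : 0 < δ) (hrb : 0 < rb)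
    (hδrb : δ ≤ rb) (hc₁ : ω ^ 2 * δ ^ 4 / (128 * rb ^ 5) ≤ c₁)
    (hc₁' : c₁ ≤ ω ^ 2 * δ ^ 4 / (2 * rb ^ 5))
    (he₁ : 3 * δ ^ 2 / (4 * rb ^ 4) ≤ e₁) (he₁' : e₁ ≤ 360 * δ ^ 2 / rb ^ 4)
    (hc₂' : c₂ ≤ 1728 * ω ^ 2 * δ ^ 3 / rb ^ 4) (he₂' : e₂ ≤ 72 * δ ^ 2 / rb ^ 4)
    (hL : L = 2 * e₁ / c₁) (hbig : 1.36e18 ≤ ω ^ 4 * δ ^ 3 * rb) :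
    (c₂ * L + e₁ + e₂) * L ^ 2 ≤ 1 := by
  have hω2 : 0 < ω ^ 2 := by positivity
  obtain ⟨hL1, hL2⟩ := thresholdBarrier_ratio_bounds hω hδ hrb hc₁ hc₁' he₁ he₁'
  rw [← hL] at hL1 hL2
  have hL0 : 0 ≤ L := le_trans (by positivity) hL1
  -- `c₂ L + e₁ + e₂ ≤ 1.6·10⁸ δ/r_b³`
  have hK : c₂ * L + e₁ + e₂ ≤ 1.6e8 * δ / rb ^ 3 := by
    have h1 : c₂ * L ≤ 1728 * ω ^ 2 * δ ^ 3 / rb ^ 4 * (92160 * rb / (ω ^ 2 * δ ^ 2)) :=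
      mul_le_mul hc₂' hL2 hL0 (by positivity)
    have e1 : 1728 * ω ^ 2 * δ ^ 3 / rb ^ 4 * (92160 * rb / (ω ^ 2 * δ ^ 2)) =
        159252480 * δ / rb ^ 3 := by field_simp; ring
    have h2 : e₁ + e₂ ≤ 432 * δ ^ 2 / rb ^ 4 := by
      have : 360 * δ ^ 2 / rb ^ 4 + 72 * δ ^ 2 / rb ^ 4 = 432 * δ ^ 2 / rb ^ 4 := by ring
      linarith
    have h3 : 432 * δ ^ 2 / rb ^ 4 ≤ 432 * δ / rb ^ 3 := by
      rw [div_le_div_iff₀ (by positivity) (by positivity)]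
      have := mul_le_mul_of_nonneg_left hδrb (show 0 ≤ 432 * δ * rb ^ 3 by positivity)
      nlinarith [this]
    have e2 : 159252480 * δ / rb ^ 3 + 432 * δ / rb ^ 3 ≤ 1.6e8 * δ / rb ^ 3 := by
      rw [← add_div, div_le_div_iff_of_pos_right (by positivity)]
      norm_num
      nlinarith
    linarith
  calc (c₂ * L + e₁ + e₂) * L ^ 2 ≤ 1.6e8 * δ / rb ^ 3 * L ^ 2 :=
        mul_le_mul_of_nonneg_right hK (sq_nonneg L)
    _ ≤ 1.6e8 * δ / rb ^ 3 * (92160 * rb / (ω ^ 2 * δ ^ 2)) ^ 2 :=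
        mul_le_mul_of_nonneg_left (pow_le_pow_left₀ hL0 hL2 2) (by positivity)
    _ = 1.6e8 * 92160 ^ 2 / (ω ^ 4 * δ ^ 3 * rb) := by
        field_simp
    _ ≤ 1 := by
        rw [div_le_one (by positivity)]
        norm_num at hbig ⊢
        linarith

/-- **Both largeness conditions from the Breitenlohner–Freedman margin and large `Λ′`.** If
`Λ′ ≤ 4ω²r_b²` (the profile zero satisfies `ω²(r_t + r₊)² ≥ Λ′`, `r_t + r₊ ≤ 2r_b`), `θ₁ r_b ≤ 3δ`
(the barrier width is `≥ θ₁r₊/2`), `0 < θ₁ ≤ 1` and `2.5·10¹⁰/θ₁³ ≤ Λ′`, then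
`368640·r_b ≤ ω²δ³` and `1.36·10¹⁸ ≤ ω⁴δ³r_b`. [folklore] -/
theorem thresholdBarrier_largeness_of_margin {Λ' θ₁ rb : ℝ} (hrb : 0 < rb)
    (hθ₁ : 0 < θ₁) (hθ₁1 : θ₁ ≤ 1) (hΛω : Λ' ≤ 4 * ω ^ 2 * rb ^ 2) (hδθ : θ₁ * rb ≤ 3 * δ)
    (hΛ : 2.5e10 / θ₁ ^ 3 ≤ Λ') :
    368640 * rb ≤ ω ^ 2 * δ ^ 3 ∧ 1.36e18 ≤ ω ^ 4 * δ ^ 3 * rb := by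
  have hω2 : 0 ≤ ω ^ 2 := sq_nonneg ω
  have hθ3 : 0 < θ₁ ^ 3 := pow_pos hθ₁ 3
  -- `Λ′ θ₁³ ≥ 2.5e10` and `θ₁³ r_b³ ≤ 27 δ³`
  have h1 : 2.5e10 ≤ Λ' * θ₁ ^ 3 := by rwa [div_le_iff₀ hθ3] at hΛ
  have h2 : θ₁ ^ 3 * rb ^ 3 ≤ 27 * δ ^ 3 := by
    have := pow_le_pow_left₀ (by positivity) hδθ 3
    nlinarith [this]
  have hΛ0 : 0 ≤ Λ' := le_trans (by positivity) hΛ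
  have hrb2 : 0 < rb ^ 2 := pow_pos hrb 2
  have hrb3 : 0 < rb ^ 3 := pow_pos hrb 3
  constructor
  · -- `Λ′θ₁³ r_b ≤ 108 ω²δ³` and `Λ′θ₁³ ≥ 2.5e10`
    have h3 : Λ' * (θ₁ ^ 3 * rb ^ 3) ≤ 4 * ω ^ 2 * rb ^ 2 * (27 * δ ^ 3) :=
      mul_le_mul hΛω h2 (by positivity) (by positivity)
    have h3' : Λ' * θ₁ ^ 3 * rb * rb ^ 2 ≤ 108 * (ω ^ 2 * δ ^ 3) * rb ^ 2 := by
      calc Λ' * θ₁ ^ 3 * rb * rb ^ 2 = Λ' * (θ₁ ^ 3 * rb ^ 3) := by ring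
        _ ≤ 4 * ω ^ 2 * rb ^ 2 * (27 * δ ^ 3) := h3
        _ = 108 * (ω ^ 2 * δ ^ 3) * rb ^ 2 := by ring
    have h6 : Λ' * θ₁ ^ 3 * rb ≤ 108 * (ω ^ 2 * δ ^ 3) := le_of_mul_le_mul_right h3' hrb2
    have h4 : 2.5e10 * rb ≤ Λ' * θ₁ ^ 3 * rb := mul_le_mul_of_nonneg_right h1 hrb.le
    nlinarith [h6, h4]
  · -- `Λ′²θ₁³ ≤ 432 ω⁴δ³ r_b` and `Λ′²θ₁³ ≥ 6.25e20`
    have h4 : Λ' ^ 2 * (θ₁ ^ 3 * rb ^ 3) ≤ (4 * ω ^ 2 * rb ^ 2) ^ 2 * (27 * δ ^ 3) :=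
      mul_le_mul (pow_le_pow_left₀ hΛ0 hΛω 2) h2 (by positivity) (by positivity)
    have h4' : Λ' ^ 2 * θ₁ ^ 3 * rb ^ 3 ≤ 432 * (ω ^ 4 * δ ^ 3 * rb) * rb ^ 3 := by
      calc Λ' ^ 2 * θ₁ ^ 3 * rb ^ 3 = Λ' ^ 2 * (θ₁ ^ 3 * rb ^ 3) := by ring
        _ ≤ (4 * ω ^ 2 * rb ^ 2) ^ 2 * (27 * δ ^ 3) := h4
        _ = 432 * (ω ^ 4 * δ ^ 3 * rb) * rb ^ 3 := by ring
    have h6 : Λ' ^ 2 * θ₁ ^ 3 ≤ 432 * (ω ^ 4 * δ ^ 3 * rb) := le_of_mul_le_mul_right h4' hrb3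
    have hΛ1 : 2.5e10 ≤ Λ' := by
      have hθ : θ₁ ^ 3 ≤ 1 := pow_le_one₀ hθ₁.le hθ₁1
      have : (2.5e10 : ℝ) ≤ 2.5e10 / θ₁ ^ 3 := by
        rw [le_div_iff₀ hθ3]; nlinarith
      linarith
    have h5 : 2.5e10 * 2.5e10 ≤ Λ' ^ 2 * θ₁ ^ 3 := by
      have := mul_le_mul hΛ1 h1 (by norm_num) hΛ0
      calc (2.5e10 : ℝ) * 2.5e10 ≤ Λ' * (Λ' * θ₁ ^ 3) := this
        _ = Λ' ^ 2 * θ₁ ^ 3 := by ring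
    norm_num at h5 h6 ⊢
    nlinarith [h5, h6]

end Constants

end Kerr

end Literature.Geometry.Lorentzian

end
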